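import Summits.AtomisticToContinuum.BoseEinsteinCondensation.Theorems.BECInfDivCoherenceGridAverageCondensate
import HarnessLib

/-!
# Route `BECInfDivCoherence`, crux `GridInfDivCoherence` (stmt-AtomisticToContinuum-9114), line `registered`
# (birth skeleton) — the exact `t = 1` case of the load-bearing stub `stub_hadamardPowerCoherence`:
# Bochner positivity of the cosine grid transform of the translation coherence

For EVERY periodic trial state `Ψ` of `N` bosons on the torus of side `L > 0`, every particle `i`,
every grid of `m ≥ 1` nodes `r_j = (L/m) j` per side and every frequency `q ∈ ℤ³`, the cosine grid
transform of the translation coherence `G(r) = Re ∫_{cell^N} conj Ψ(…, xᵢ + r, …) Ψ(X) dX` is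
non-negative:

  `0 ≤ Σ_{j ∈ (ℤ/m)³} G(r_j) cos(2π q·j/m)`.

This is the `t = 1` instance of `stub_hadamardPowerCoherence` of the line (there claimed for every
Hadamard power `G^t`, `0 < t ≤ 1`, of the coherence of near-minimisers, up to `−εt`); at `t = 1` it is an
exact theorem with no energy condition, no smallness and no tolerance — Bochner's theorem for the unitary
representation of the grid translations, made explicit by aliasing: with the one-body Fourier
coefficients `ĉ_k(φ_Y)` of the slices `φ_Y = Ψ(·, Y)`,

  `Σ_j cos(2π q·j/m) ∫_cell conj φ(x + r_j) φ(x) dx = L³ Σ_k w_q(k) |ĉ_k(φ)|²`,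
  `w_q(k) = (m³/2)([k ≡ q (m)] + [k ≡ −q (m)]) ≥ 0`

(polarised Parseval + translate rule + the character sum `Σ_j e_{n}(r_j) = m³[n ∈ mℤ³]`, all from
`BECInfDivCoherenceGridAverageCondensateFourier.lean`), then Fubini over `Y ∈ cell^{N-1}` after moving
particle `i` to slot `0` by Bose symmetry (as in `BECInfDivCoherenceGridAverageCondensate.lean`, whose
`q = 0` case this file generalises).

Main results: `sum_cos_mul_integral_translate_eq` (one body), `sum_re_cos_coherence_grid_nonneg`
(`N` bodies) and the crux-shaped corollary `hadamardPowerCoherence_one` (grid `m = ⌊L/η⌋₊`,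
`q : Fin 3 → Fin m`, division by `m³`). All folklore (finite Fourier analysis on the torus; Bochner 1933
for the sign).
-/

noncomputable section

open MeasureTheory Filter Complex
open scoped ENNReal NNReal ComplexConjugate

namespace Summit.AtomisticToContinuum.BoseEinsteinCondensation.Theorems.BECInfDivCoherenceGridInfDiv

open Literature.MathematicalPhysics.QuantumManyBody.BoseGas
open Summit.AtomisticToContinuum.BoseEinsteinCondensation.Theorems.BECInfDivCoherenceGridAverage

variable {L : ℝ}

/-! ### Characters on the grid -/

/-- The plane wave `e_q` at the grid node `r_j = (L/m) j` is the grid character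
`exp(i · 2π (Σ_a q_a j_a)/m)`. [folklore] -/
theorem cellWave_grid_node (hL : L ≠ 0) {m : ℕ} (hm : 0 < m) (q : Fin 3 → ℤ) (j : Fin 3 → Fin m) :
    cellWave L q (latticeVec (L / m) (fun a => ((j a : ℕ) : ℤ))) =
      Complex.exp (((2 * Real.pi * (∑ a, (q a : ℝ) * ((j a : ℕ) : ℝ)) / m : ℝ) : ℂ) * Complex.I) := by
  rw [cellWave_apply]
  congr 1
  have hm0 : (m : ℂ) ≠ 0 := by exact_mod_cast hm.ne'
  have hL' : (L : ℂ) ≠ 0 := by exact_mod_cast hL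
  simp only [latticeVec, PiLp.toLp_apply, Int.cast_natCast]
  push_cast
  rw [Finset.mul_sum, Finset.sum_div, Finset.mul_sum, Finset.sum_div, Finset.sum_mul]
  refine Finset.sum_congr rfl fun a _ => ?_
  field_simp

/-- The real grid character as the mean of two plane waves at the node:
`cos(2π q·j/m) = (e_q(r_j) + e_{−q}(r_j))/2`. [folklore] -/
theorem ofReal_cos_grid (hL : L ≠ 0) {m : ℕ} (hm : 0 < m) (q : Fin 3 → ℤ) (j : Fin 3 → Fin m) :
    ((Real.cos (2 * Real.pi * (∑ a, (q a : ℝ) * ((j a : ℕ) : ℝ)) / m) : ℝ) : ℂ) =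
      (cellWave L q (latticeVec (L / m) (fun a => ((j a : ℕ) : ℤ))) +
        cellWave L (-q) (latticeVec (L / m) (fun a => ((j a : ℕ) : ℤ)))) / 2 := by
  rw [← conj_cellWave, cellWave_grid_node hL hm, ← Complex.exp_conj, map_mul, Complex.conj_ofReal,
    Complex.conj_I, mul_neg, ← neg_mul, Complex.ofReal_cos, ← Complex.two_cos]
  ring

/-- **Weighted character sum over the grid**: for `q, k ∈ ℤ³`,
`Σ_j cos(2π q·j/m) conj e_k(r_j) = (m³/2)([q − k ∈ mℤ³] + [−q − k ∈ mℤ³])`. [folklore] -/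
theorem sum_cos_mul_conj_cellWave_grid (hL : L ≠ 0) {m : ℕ} (hm : 0 < m) (q k : Fin 3 → ℤ) :
    ∑ j : Fin 3 → Fin m, ((Real.cos (2 * Real.pi * (∑ a, (q a : ℝ) * ((j a : ℕ) : ℝ)) / m) : ℝ) : ℂ) *
        conj (cellWave L k (latticeVec (L / m) (fun a => ((j a : ℕ) : ℤ)))) =
      ((if (∀ a, (m : ℤ) ∣ (q - k) a) then (m : ℂ) ^ 3 else 0) +
        (if (∀ a, (m : ℤ) ∣ (-q - k) a) then (m : ℂ) ^ 3 else 0)) / 2 := by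
  have h : ∀ j : Fin 3 → Fin m,
      ((Real.cos (2 * Real.pi * (∑ a, (q a : ℝ) * ((j a : ℕ) : ℝ)) / m) : ℝ) : ℂ) *
        conj (cellWave L k (latticeVec (L / m) (fun a => ((j a : ℕ) : ℤ)))) =
      (cellWave L (q - k) (latticeVec (L / m) (fun a => ((j a : ℕ) : ℤ))) +
        cellWave L (-q - k) (latticeVec (L / m) (fun a => ((j a : ℕ) : ℤ)))) / 2 := by
    intro j
    rw [ofReal_cos_grid hL hm, conj_cellWave, sub_eq_add_neg, sub_eq_add_neg, cellWave_add_index,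
      cellWave_add_index]
    ring
  rw [Finset.sum_congr rfl fun j _ => h j, ← Finset.sum_div, Finset.sum_add_distrib,
    sum_cellWave_grid hL hm, sum_cellWave_grid hL hm]

/-! ### One body: the weighted aliasing identity -/

/-- **Cosine-weighted grid sum of autocorrelations, momentum form.** For continuous `Lℤ³`-periodic
`φ`, `m ≥ 1` and `q ∈ ℤ³`:
`L⁻³ Σ_j cos(2π q·j/m) ∫_cell conj φ(x + r_j) φ(x) dx = Σ_k w_q(k) |ĉ_k(φ)|²` as a complex `HasSum`,
with the non-negative weights `w_q(k) = (m³/2)([q − k ∈ mℤ³] + [−q − k ∈ mℤ³])`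
(polarised Parseval + translate rule + weighted character sum). [folklore] -/
theorem hasSum_grid_cos (hL : 0 < L) {m : ℕ} (hm : 0 < m) {φ : Space → ℂ} (hφ : Continuous φ)
    (hper : ∀ (x : Space) (k : Fin 3), φ (x + EuclideanSpace.single k L) = φ x) (q : Fin 3 → ℤ) :
    HasSum (fun k : Fin 3 → ℤ =>
        (((((if (∀ a, (m : ℤ) ∣ (q - k) a) then (m : ℝ) ^ 3 else 0) +
            (if (∀ a, (m : ℤ) ∣ (-q - k) a) then (m : ℝ) ^ 3 else 0)) / 2 *
          ‖cellFourierCoeff L φ k‖ ^ 2 : ℝ)) : ℂ))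
      (((L ^ 3)⁻¹ : ℝ) • ∑ j : Fin 3 → Fin m,
        ((Real.cos (2 * Real.pi * (∑ a, (q a : ℝ) * ((j a : ℕ) : ℝ)) / m) : ℝ) : ℂ) *
          ∫ x in cell L, conj (φ (x + latticeVec (L / m) (fun a => ((j a : ℕ) : ℤ)))) * φ x) := by
  have hj : ∀ j : Fin 3 → Fin m, HasSum (fun k : Fin 3 → ℤ =>
      ((Real.cos (2 * Real.pi * (∑ a, (q a : ℝ) * ((j a : ℕ) : ℝ)) / m) : ℝ) : ℂ) *
        (conj (cellWave L k (latticeVec (L / m) (fun a => ((j a : ℕ) : ℤ)))) *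
          (((‖cellFourierCoeff L φ k‖ ^ 2 : ℝ)) : ℂ)))
      (((Real.cos (2 * Real.pi * (∑ a, (q a : ℝ) * ((j a : ℕ) : ℝ)) / m) : ℝ) : ℂ) *
        (((L ^ 3)⁻¹ : ℝ) • ∫ x in cell L,
          conj (φ (x + latticeVec (L / m) (fun a => ((j a : ℕ) : ℤ)))) * φ x)) := by
    intro j
    have h := hasSum_conj_cellFourierCoeff_mul' hL
      (φ := fun x => φ (x + latticeVec (L / m) (fun a => ((j a : ℕ) : ℤ))))
      (hφ.comp (continuous_id.add continuous_const)) hφ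
    refine HasSum.mul_left _ (h.congr_fun fun k => ?_)
    exact (conj_cellFourierCoeff_translate_mul hL hper _ k).symm
  have hsum := hasSum_sum (s := (Finset.univ : Finset (Fin 3 → Fin m))) fun j _ => hj j
  have hval : (((L ^ 3)⁻¹ : ℝ) • ∑ j : Fin 3 → Fin m,
      ((Real.cos (2 * Real.pi * (∑ a, (q a : ℝ) * ((j a : ℕ) : ℝ)) / m) : ℝ) : ℂ) *
        ∫ x in cell L, conj (φ (x + latticeVec (L / m) (fun a => ((j a : ℕ) : ℤ)))) * φ x) =
      ∑ j : Fin 3 → Fin m,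
        ((Real.cos (2 * Real.pi * (∑ a, (q a : ℝ) * ((j a : ℕ) : ℝ)) / m) : ℝ) : ℂ) *
          (((L ^ 3)⁻¹ : ℝ) • ∫ x in cell L,
            conj (φ (x + latticeVec (L / m) (fun a => ((j a : ℕ) : ℤ)))) * φ x) := by
    rw [Finset.smul_sum]
    refine Finset.sum_congr rfl fun j _ => ?_
    rw [mul_smul_comm]
  rw [hval]
  refine hsum.congr_fun fun k => ?_
  have hre : (∑ j : Fin 3 → Fin m,
      ((Real.cos (2 * Real.pi * (∑ a, (q a : ℝ) * ((j a : ℕ) : ℝ)) / m) : ℝ) : ℂ) *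
        (conj (cellWave L k (latticeVec (L / m) (fun a => ((j a : ℕ) : ℤ)))) *
          (((‖cellFourierCoeff L φ k‖ ^ 2 : ℝ)) : ℂ))) =
      (∑ j : Fin 3 → Fin m,
        ((Real.cos (2 * Real.pi * (∑ a, (q a : ℝ) * ((j a : ℕ) : ℝ)) / m) : ℝ) : ℂ) *
          conj (cellWave L k (latticeVec (L / m) (fun a => ((j a : ℕ) : ℤ))))) *
        (((‖cellFourierCoeff L φ k‖ ^ 2 : ℝ)) : ℂ) := by
    rw [Finset.sum_mul]
    refine Finset.sum_congr rfl fun j _ => ?_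
    ring
  rw [hre, sum_cos_mul_conj_cellWave_grid hL.ne' hm q k]
  split_ifs <;> push_cast <;> ring

/-- **Real form of `hasSum_grid_cos`**: the weighted coarse Parseval sum is summable, has
non-negative terms, and
`Σ_j cos(2π q·j/m) ∫_cell conj φ(x + r_j) φ(x) dx = L³ Σ_k w_q(k) |ĉ_k(φ)|²` (a real number `≥ 0`).
[folklore] -/
theorem sum_cos_mul_integral_translate_eq (hL : 0 < L) {m : ℕ} (hm : 0 < m) {φ : Space → ℂ}
    (hφ : Continuous φ)
    (hper : ∀ (x : Space) (k : Fin 3), φ (x + EuclideanSpace.single k L) = φ x) (q : Fin 3 → ℤ) :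
    Summable (fun k : Fin 3 → ℤ =>
        (((if (∀ a, (m : ℤ) ∣ (q - k) a) then (m : ℝ) ^ 3 else 0) +
            (if (∀ a, (m : ℤ) ∣ (-q - k) a) then (m : ℝ) ^ 3 else 0)) / 2 *
          ‖cellFourierCoeff L φ k‖ ^ 2 : ℝ)) ∧
    (∀ k : Fin 3 → ℤ, 0 ≤ (((if (∀ a, (m : ℤ) ∣ (q - k) a) then (m : ℝ) ^ 3 else 0) +
            (if (∀ a, (m : ℤ) ∣ (-q - k) a) then (m : ℝ) ^ 3 else 0)) / 2 *
          ‖cellFourierCoeff L φ k‖ ^ 2 : ℝ)) ∧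
    (∑ j : Fin 3 → Fin m,
        ((Real.cos (2 * Real.pi * (∑ a, (q a : ℝ) * ((j a : ℕ) : ℝ)) / m) : ℝ) : ℂ) *
          ∫ x in cell L, conj (φ (x + latticeVec (L / m) (fun a => ((j a : ℕ) : ℤ)))) * φ x) =
      (((L ^ 3 * ∑' k : Fin 3 → ℤ,
        (((if (∀ a, (m : ℤ) ∣ (q - k) a) then (m : ℝ) ^ 3 else 0) +
            (if (∀ a, (m : ℤ) ∣ (-q - k) a) then (m : ℝ) ^ 3 else 0)) / 2 *
          ‖cellFourierCoeff L φ k‖ ^ 2 : ℝ)) : ℝ) : ℂ) := by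
  have h := hasSum_grid_cos hL hm hφ hper q
  set v : ℂ := ((L ^ 3)⁻¹ : ℝ) • ∑ j : Fin 3 → Fin m,
    ((Real.cos (2 * Real.pi * (∑ a, (q a : ℝ) * ((j a : ℕ) : ℝ)) / m) : ℝ) : ℂ) *
      ∫ x in cell L, conj (φ (x + latticeVec (L / m) (fun a => ((j a : ℕ) : ℤ)))) * φ x with hv
  have hre : HasSum (fun k : Fin 3 → ℤ =>
      (((if (∀ a, (m : ℤ) ∣ (q - k) a) then (m : ℝ) ^ 3 else 0) +
          (if (∀ a, (m : ℤ) ∣ (-q - k) a) then (m : ℝ) ^ 3 else 0)) / 2 *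
        ‖cellFourierCoeff L φ k‖ ^ 2 : ℝ)) v.re := by
    have := Complex.reCLM.hasSum h
    simpa only [Complex.reCLM_apply, Complex.ofReal_re] using this
  have him : v.im = 0 := by
    have h1 : HasSum (fun _ : Fin 3 → ℤ => (0 : ℝ)) v.im := by
      have := Complex.imCLM.hasSum h
      simpa only [Complex.imCLM_apply, Complex.ofReal_im] using this
    exact h1.unique hasSum_zero
  refine ⟨hre.summable, fun k => ?_, ?_⟩
  · have h3 : (0 : ℝ) ≤ (m : ℝ) ^ 3 := by positivity
    refine mul_nonneg (div_nonneg (add_nonneg ?_ ?_) zero_le_two) (sq_nonneg _) <;>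
      split_ifs <;> simp [h3]
  have hL3 : (L ^ 3 : ℝ) ≠ 0 := pow_ne_zero _ hL.ne'
  have hvS : (∑ j : Fin 3 → Fin m,
      ((Real.cos (2 * Real.pi * (∑ a, (q a : ℝ) * ((j a : ℕ) : ℝ)) / m) : ℝ) : ℂ) *
        ∫ x in cell L, conj (φ (x + latticeVec (L / m) (fun a => ((j a : ℕ) : ℤ)))) * φ x) =
        (L ^ 3 : ℝ) • v := by
    rw [hv, smul_smul, mul_inv_cancel₀ hL3, one_smul]
  have hvre : v = ((v.re : ℝ) : ℂ) := Complex.ext (by simp) (by simp [him])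
  rw [hvS, hvre, hre.tsum_eq, Complex.real_smul, ← Complex.ofReal_mul]

/-! ### `N` bodies: Bose symmetry, Fubini over the spectator particles, and the sign -/

section ManyBody

variable {n : ℕ}

/-- **Bochner positivity of the cosine grid transform of the translation coherence** (the exact
`t = 1` case of `stub_hadamardPowerCoherence`, for EVERY periodic trial state — no energy condition).
For `Ψ` a periodic trial state of `n + 1` bosons on the torus of side `L > 0`, a particle `i`, a grid of
`m ≥ 1` nodes `r_j = (L/m) j` per side and `q ∈ ℤ³`:
`0 ≤ Σ_j (Re ∫_{cell^{n+1}} conj Ψ(update X i (xᵢ + r_j)) Ψ(X) dX) · cos(2π q·j/m)`.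
Proof: the sum is `Re ∫_{cell^n} L³ Σ_k w_q(k) |ĉ_k(Ψ(·, Y))|² dY` with `w_q ≥ 0`
(`sum_cos_mul_integral_translate_eq` slice by slice, after Bose symmetry and Fubini). [folklore] -/
theorem sum_re_cos_coherence_grid_nonneg (hL : 0 < L) {m : ℕ} (hm : 0 < m)
    (Ψ : PeriodicTrialState (n + 1) L) (i : Fin (n + 1)) (q : Fin 3 → ℤ) :
    0 ≤ ∑ j : Fin 3 → Fin m, (∫ X in cellN (n + 1) L,
        conj (Ψ.ψ (Function.update X i (X i + latticeVec (L / m) (fun a => ((j a : ℕ) : ℤ))))) *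
          Ψ.ψ X).re * Real.cos (2 * Real.pi * (∑ a, (q a : ℝ) * ((j a : ℕ) : ℝ)) / m) := by
  have hΨc : Continuous Ψ.ψ := Ψ.contDiff.continuous
  -- single-shift slice identity: Bose symmetry to slot `0`, then Fubini (tagged slot innermost)
  have hslice : ∀ s : Space,
      ∫ X in cellN (n + 1) L, conj (Ψ.ψ (Function.update X i (X i + s))) * Ψ.ψ X =
        ∫ Y in cellN n L, ∫ x in cell L,
          conj (Ψ.ψ (Matrix.vecCons (x + s) Y)) * Ψ.ψ (Matrix.vecCons x Y) := by
    intro s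
    set F : Config (n + 1) → ℂ := fun Z => conj (Ψ.ψ (Z + Pi.single 0 s)) * Ψ.ψ Z with hF
    have hFc : Continuous F :=
      (Complex.continuous_conj.comp (hΨc.comp (continuous_id.add continuous_const))).mul hΨc
    have h1 : (fun X : Config (n + 1) => conj (Ψ.ψ (Function.update X i (X i + s))) * Ψ.ψ X) =
        fun X => F (X ∘ Equiv.swap 0 i) := by
      funext X
      exact conj_update_mul_eq_comp_swap Ψ i s X
    rw [h1, setIntegral_cellN_comp_perm L (Equiv.swap 0 i) F,
      setIntegral_cellN_succ_right_of_continuous hFc]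
    refine integral_congr_ae (Eventually.of_forall fun Y => ?_)
    refine integral_congr_ae (Eventually.of_forall fun x => ?_)
    simp only [hF, ← vecCons_add_left]
  -- each slice integral `Y ↦ ∫_cell …` is integrable on `cell^n`
  have hint : ∀ j : Fin 3 → Fin m, Integrable (fun Y : Config n => ∫ x in cell L,
      conj (Ψ.ψ (Matrix.vecCons (x + latticeVec (L / m) (fun a => ((j a : ℕ) : ℤ))) Y)) *
        Ψ.ψ (Matrix.vecCons x Y)) (volume.restrict (cellN n L)) := by
    intro j
    set s : Space := latticeVec (L / m) (fun a => ((j a : ℕ) : ℤ)) with hs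
    have hFc : Continuous fun Z : Config (n + 1) => conj (Ψ.ψ (Z + Pi.single 0 s)) * Ψ.ψ Z :=
      (Complex.continuous_conj.comp (hΨc.comp (continuous_id.add continuous_const))).mul hΨc
    have h := (integrable_comp_vecCons_prod_restrict (L := L) hFc).integral_prod_right
    refine h.congr (Eventually.of_forall fun Y => ?_)
    refine integral_congr_ae (Eventually.of_forall fun x => ?_)
    simp only [← vecCons_add_left]
  -- per slice: continuity and periodicity of `φ_Y = Ψ(·, Y)`, hence the weighted aliasing identity
  have hφ : ∀ Y : Config n, Continuous (fun x => Ψ.ψ (Matrix.vecCons x Y)) ∧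
      (∀ (x : Space) (k : Fin 3),
        Ψ.ψ (Matrix.vecCons (x + EuclideanSpace.single k L) Y) = Ψ.ψ (Matrix.vecCons x Y)) :=
    fun Y => ⟨continuous_vecCons_slice hΨc Y, fun x k => Ψ.vecCons_add_axis x Y k⟩
  set t : Config n → ℝ := fun Y => ∑' k : Fin 3 → ℤ,
    (((if (∀ a, (m : ℤ) ∣ (q - k) a) then (m : ℝ) ^ 3 else 0) +
        (if (∀ a, (m : ℤ) ∣ (-q - k) a) then (m : ℝ) ^ 3 else 0)) / 2 *
      ‖cellFourierCoeff L (fun x => Ψ.ψ (Matrix.vecCons x Y)) k‖ ^ 2 : ℝ) with ht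
  have hpt : ∀ Y : Config n, (∑ j : Fin 3 → Fin m,
      ((Real.cos (2 * Real.pi * (∑ a, (q a : ℝ) * ((j a : ℕ) : ℝ)) / m) : ℝ) : ℂ) *
        ∫ x in cell L, conj (Ψ.ψ (Matrix.vecCons
          (x + latticeVec (L / m) (fun a => ((j a : ℕ) : ℤ))) Y)) * Ψ.ψ (Matrix.vecCons x Y)) =
      (((L ^ 3 * t Y) : ℝ) : ℂ) :=
    fun Y => (sum_cos_mul_integral_translate_eq hL hm (hφ Y).1 (hφ Y).2 q).2.2
  have htnn : ∀ Y : Config n, 0 ≤ t Y := fun Y =>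
    tsum_nonneg (sum_cos_mul_integral_translate_eq hL hm (hφ Y).1 (hφ Y).2 q).2.1
  -- the weighted sum of the `N`-body integrals is one integral over `Y` of a non-negative function
  have hkey : (∑ j : Fin 3 → Fin m,
      ((Real.cos (2 * Real.pi * (∑ a, (q a : ℝ) * ((j a : ℕ) : ℝ)) / m) : ℝ) : ℂ) *
        ∫ X in cellN (n + 1) L, conj (Ψ.ψ (Function.update X i
          (X i + latticeVec (L / m) (fun a => ((j a : ℕ) : ℤ))))) * Ψ.ψ X) =
      ∫ Y in cellN n L, (((L ^ 3 * t Y) : ℝ) : ℂ) := by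
    calc (∑ j : Fin 3 → Fin m,
        ((Real.cos (2 * Real.pi * (∑ a, (q a : ℝ) * ((j a : ℕ) : ℝ)) / m) : ℝ) : ℂ) *
          ∫ X in cellN (n + 1) L, conj (Ψ.ψ (Function.update X i
            (X i + latticeVec (L / m) (fun a => ((j a : ℕ) : ℤ))))) * Ψ.ψ X)
        = ∑ j : Fin 3 → Fin m, ∫ Y in cellN n L,
            ((Real.cos (2 * Real.pi * (∑ a, (q a : ℝ) * ((j a : ℕ) : ℝ)) / m) : ℝ) : ℂ) *
              ∫ x in cell L, conj (Ψ.ψ (Matrix.vecCons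
                (x + latticeVec (L / m) (fun a => ((j a : ℕ) : ℤ))) Y)) *
                  Ψ.ψ (Matrix.vecCons x Y) := by
          refine Finset.sum_congr rfl fun j _ => ?_
          rw [hslice, ← integral_const_mul]
      _ = ∫ Y in cellN n L, ∑ j : Fin 3 → Fin m,
            ((Real.cos (2 * Real.pi * (∑ a, (q a : ℝ) * ((j a : ℕ) : ℝ)) / m) : ℝ) : ℂ) *
              ∫ x in cell L, conj (Ψ.ψ (Matrix.vecCons
                (x + latticeVec (L / m) (fun a => ((j a : ℕ) : ℤ))) Y)) *
                  Ψ.ψ (Matrix.vecCons x Y) := by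
          rw [integral_finsetSum _ (fun j _ => (hint j).const_mul _)]
      _ = ∫ Y in cellN n L, (((L ^ 3 * t Y) : ℝ) : ℂ) :=
          integral_congr_ae (Eventually.of_forall hpt)
  -- conclude: real parts
  have hre : (∑ j : Fin 3 → Fin m, (∫ X in cellN (n + 1) L,
      conj (Ψ.ψ (Function.update X i (X i + latticeVec (L / m) (fun a => ((j a : ℕ) : ℤ))))) *
        Ψ.ψ X).re * Real.cos (2 * Real.pi * (∑ a, (q a : ℝ) * ((j a : ℕ) : ℝ)) / m)) =
      (∑ j : Fin 3 → Fin m,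
        ((Real.cos (2 * Real.pi * (∑ a, (q a : ℝ) * ((j a : ℕ) : ℝ)) / m) : ℝ) : ℂ) *
          ∫ X in cellN (n + 1) L, conj (Ψ.ψ (Function.update X i
            (X i + latticeVec (L / m) (fun a => ((j a : ℕ) : ℤ))))) * Ψ.ψ X).re := by
    rw [Complex.re_sum]
    refine Finset.sum_congr rfl fun j _ => ?_
    rw [Complex.re_ofReal_mul, mul_comm]
  rw [hre, hkey, integral_complex_ofReal, Complex.ofReal_re]
  exact integral_nonneg fun Y => mul_nonneg (pow_nonneg hL.le 3) (htnn Y)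

end ManyBody

end Summit.AtomisticToContinuum.BoseEinsteinCondensation.Theorems.BECInfDivCoherenceGridInfDiv

namespace Summit.AtomisticToContinuum.BoseEinsteinCondensation.Theorems

open Literature.MathematicalPhysics.QuantumManyBody.BoseGas
open Summit.AtomisticToContinuum.BoseEinsteinCondensation.Theorems.BECInfDivCoherenceGridInfDiv

/-- **`stub_hadamardPowerCoherence` at `t = 1`, unconditionally** (crux `GridInfDivCoherence`,
stmt-AtomisticToContinuum-9114, line `registered`; the crux's own objects). For every `N`, every side
`L > 0`, every UV scale `η`, EVERY periodic trial state `Ψ` of `N` bosons (no energy condition) and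
every particle `i`, with `m = ⌊L/η⌋₊` and the translation coherence
`G(r) = Re ∫_{cell^N} conj Ψ(update X i (xᵢ + r)) Ψ(X) dX`, all grid weights of `G = G^1` are
non-negative: `0 ≤ m⁻³ Σ_j G((L/m) j) cos(2π q·j/m)` for every `q : (Fin 3 → Fin m)` — in particular
`−ε·1 ≤ …` for every `ε ≥ 0`, the `t = 1` instance of the stub's conclusion (`G^1 = G`,
`Real.rpow_one`). This is Bochner's theorem for the grid translations; the content of the stub is the
extension to the fractional Hadamard powers `G^t`, `0 < t < 1` (infinite divisibility). [folklore] -/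
theorem hadamardPowerCoherence_one :
    ∀ (N : ℕ) (L η : ℝ), 0 < L → ∀ (Ψ : PeriodicTrialState N L) (i : Fin N),
      let m : ℕ := ⌊L / η⌋₊;
      let G : EuclideanSpace ℝ (Fin 3) → ℝ := fun r =>
        (∫ X in cellN N L, conj (Ψ.ψ (Function.update X i (X i + r))) * Ψ.ψ X).re;
      ∀ q : Fin 3 → Fin m,
        0 ≤ (∑ j : Fin 3 → Fin m, G (latticeVec (L / m) (fun k => ((j k : ℕ) : ℤ))) *
              Real.cos (2 * Real.pi * (∑ k, ((q k : ℕ) : ℝ) * ((j k : ℕ) : ℝ)) / m)) /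
            (m : ℝ) ^ 3 := by
  intro N L η hL Ψ i m G q
  have hm : 0 < m := Fin.pos (q 0)
  cases N with
  | zero => exact i.elim0
  | succ n =>
    refine div_nonneg ?_ (by positivity)
    have h := sum_re_cos_coherence_grid_nonneg hL hm Ψ i (fun k => ((q k : ℕ) : ℤ))
    simpa only [Int.cast_natCast] using h

end Summit.AtomisticToContinuum.BoseEinsteinCondensation.Theorems

end
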